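import Literature.NumberTheory.EllipticCurves.TowerLocalH1LiftExactProofs
import HarnessLib

/-!
# Sub- and quotient towers of a presented tower of discrete Galois modules: the restricted and the induced
# two-index families satisfy the same eight identities (theorems only)

`Proofs` file (theorems only; no definition, no named fact, no instance, no `sorry`).  Topic `NumberTheory/EllipticCurves`
(cell `pub/bsd-print-x9`, D1 road, brick (B1) of `HOME/p1/H4-EXACT-AT-P-PLAN-x10b-p1-g8.md`; companion of
`TowerLocalH1LiftExactProofs` (x10b-p1-w7: the PRESENTATION of a tower `W_j = T/π^j` of finite discrete `Γ_F`-modules by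
ONE two-index family `f a b : W a → W b` — reductions for `b ≤ a`, injections `×π^{b-a}` for `a ≤ b` — subject to the eight
identities `hid / hcomp / hsq / hinj / hsurj / hex / hpow / hkill`) and of `StrictSubgroupFunctorialityProofs` (x10b-p1-w6:
the strict cores `ker (H¹(W) → H¹(W/W⁺))` are functorial along maps preserving `W⁺`).

Howard 2004, Def. 3.2.5 / Def. 3.2.6 / Lemma 3.2.7 [arXiv:1202.6340 p. 16]: at a place `v ∣ p` the compact module `T`
carries the ORDINARY filtration `0 → Fil_v T → T → gr_v T → 0`, compatible with the tower `T/π^j`; the local analysis of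
the ordinary condition (H.4 (Exact) at `v ∣ p`, H.5(b) at `v ∣ p`) runs on the SUB-tower `Fil_v W_j` and the QUOTIENT tower
`gr_v W_j = W_j / Fil_v W_j`.  This file supplies them GENERICALLY (any field `F`, no arithmetic): for `Γ_F`-stable
`Fil j ≤ W j` mapped into each other by every `f a b` —

* §1 **the restricted family** on the subrepresentations `(ρ j).subrepresentation (Fil j)`: existence of a (unique)
  family `g a b` with `(g a b x : W b) = f a b x` (`exists_subFamily_apply_eq`), and, for ANY such family, the eight
  identities (`subFamily_id/_comp/_sq/_injective/_surjective/_exact/_pow/_kill`) — `hsurj` from the levelwise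
  surjectivity `f (ℓ+n) n (Fil (ℓ+n)) = Fil n` (ONTO), `hex` from the SATURATION `f ℓ (ℓ+n) ⁻¹ (Fil (ℓ+n)) = Fil ℓ` (SAT:
  automatic for direct summands compatible with `×π`);
* §2 **the induced family** on the quotients `(ρ j).quotient (Fil j)` (tree `ContinuousRep.quotient`): existence of a
  family `q a b` with `q a b (mk x) = mk (f a b x)` (`exists_quotFamily_apply_mk`) and the eight identities for any such
  family (`quotFamily_…`) — `hinj` from (SAT), `hex` from `hex` + (ONTO);
* §3 the sub and quotient presentations as short exact sequences `0 → Fil ℓ → Fil (ℓ+n) → Fil n → 0`,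
  `0 → gr ℓ → gr (ℓ+n) → gr n → 0` (tree `IsSES`: `isSES_subFamily`, `isSES_quotFamily`); the levelwise
  `0 → Fil j → W j → W j ⧸ Fil j → 0` is the tree's `isSES_subtype_mkQ`, and the squares with `g / f / q` hold on elements by
  `hg` / `hq` — the shape the naturality of `δ₀`, `δ₁` (`IsSES.cohomologyMap_δ₀/δ₁`) consumes;
* §4 transport of the filtration hypotheses (map) / (ONTO) / (SAT) from `Fil` to `θ(Fil)` along levelwise additive
  (bijective, for (SAT)) maps `θ j` commuting with the family — the twisted side `δ_v · Fil_{σv}` of H.4 at `v`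
  (`map_mem_map_of_comm`, `onto_map_of_comm`, `sat_map_of_comm`);
* the `H¹`-consequences (strict cores along the family, detection through the quotient tower, lifting through the
  sub-tower) are in the companion `TowerPresentedSubquotientCohomologyProofs`.

Everything is [folklore] functoriality / long-exact-sequence bookkeeping, recorded against Howard §3.2 and Serre I §2.2.
Seat `bsd-line-x10b-p1-w6` g2.  No summit statement is proved; BSD is not proved by any of this.

References: [Howard2004HeegnerKolyvagin] B. Howard, Compositio Math. 140 (2004), Def. 1.1.3, Def. 3.2.5–3.2.6, Lemma 3.2.7
(arXiv:1202.6340 p. 5, p. 16); [SerreGaloisCohomology1997] I §2.2; [GreenbergLNM1716] §2.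
-/

noncomputable section

open CategoryTheory
open scoped ContRepresentation

namespace Literature.NumberTheory.EllipticCurves

namespace Tower

open Literature.NumberTheory.GaloisRepresentations

variable {F : Type} [Field F]
variable {W : ℕ → Type} [∀ j, AddCommGroup (W j)] [∀ j, TopologicalSpace (W j)]
  [∀ j, DiscreteTopology (W j)]
variable (ρ : ∀ j, DiscreteGaloisModule F (W j))
variable (f : ∀ a b, (ρ a).toContRepresentation →ⁱL (ρ b).toContRepresentation)
variable (Fil : ∀ j, Submodule ℤ (W j))
variable (hΓ : ∀ j (σ : Field.absoluteGaloisGroup F), Fil j ≤ (Fil j).comap (ρ j σ))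

/-! ## §1 The restricted family on the sub-tower `Fil j` -/

section Sub

/-- **Existence of the restricted family**: if every `f a b` maps `Fil a` into `Fil b`, there is a two-index family of
continuous equivariant maps `g a b : Fil a → Fil b` of the subrepresentations with `(g a b x : W b) = f a b x`.
[cite: Howard2004HeegnerKolyvagin, Def. 3.2.5–3.2.6 (arXiv p. 16: Fil_v 𝐓 compatible with the tower)] [folklore] -/
theorem exists_subFamily_apply_eq (hmap : ∀ a b, ∀ w ∈ Fil a, f a b w ∈ Fil b) :
    ∃ g : ∀ a b, ((ρ a).subrepresentation (Fil a) (hΓ a)).toContRepresentation →ⁱL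
        ((ρ b).subrepresentation (Fil b) (hΓ b)).toContRepresentation,
      ∀ a b (x : Fil a), (g a b x : W b) = f a b x := by
  refine ⟨fun a b ↦
    { toContinuousLinearMap :=
        ⟨((f a b).toContinuousLinearMap.toLinearMap.restrict fun w hw ↦ hmap a b w hw), continuous_of_discreteTopology⟩
      isIntertwining' := fun σ ↦ ContinuousLinearMap.ext fun x ↦ Subtype.ext ((f a b).isIntertwining σ (x : W a)) },
    fun a b x ↦ rfl⟩

variable {ρ f Fil hΓ}
variable {g : ∀ a b, ((ρ a).subrepresentation (Fil a) (hΓ a)).toContRepresentation →ⁱL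
    ((ρ b).subrepresentation (Fil b) (hΓ b)).toContRepresentation}
  (hg : ∀ a b (x : Fil a), (g a b x : W b) = f a b x)
include hg

/-- `g a a = id` from `f a a = id`. [cite: Howard2004HeegnerKolyvagin, Def. 1.1.3 (arXiv p. 5)] [folklore] -/
theorem subFamily_id (hid : ∀ a (w : W a), f a a w = w) (a : ℕ) (x : Fil a) : g a a x = x :=
  Subtype.ext ((hg a a x).trans (hid a x))

/-- Reductions compose on the sub-tower. [cite: Howard2004HeegnerKolyvagin, Def. 1.1.3 (arXiv p. 5)] [folklore] -/
theorem subFamily_comp (hcomp : ∀ a b c, c ≤ b → b ≤ a → ∀ w : W a, f b c (f a b w) = f a c w)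
    (a b c : ℕ) (hcb : c ≤ b) (hba : b ≤ a) (x : Fil a) : g b c (g a b x) = g a c x :=
  Subtype.ext (by rw [hg, hg, hg, hcomp a b c hcb hba])

/-- The mixed square on the sub-tower. [cite: Howard2004HeegnerKolyvagin, Def. 1.1.3 (arXiv p. 5)] [folklore] -/
theorem subFamily_sq
    (hsq : ∀ a b, a ≤ b → ∀ w : W (a + 1), f a b (f (a + 1) a w) = f (b + 1) b (f (a + 1) (b + 1) w))
    (a b : ℕ) (hab : a ≤ b) (x : Fil (a + 1)) : g a b (g (a + 1) a x) = g (b + 1) b (g (a + 1) (b + 1) x) :=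
  Subtype.ext (by rw [hg, hg, hg, hg, hsq a b hab])

/-- The up-maps of the sub-tower are injective. [cite: Howard2004HeegnerKolyvagin, §1.6 (arXiv p. 12)] [folklore] -/
theorem subFamily_injective (hinj : ∀ ℓ n, Function.Injective (f ℓ (ℓ + n))) (ℓ n : ℕ) :
    Function.Injective (g ℓ (ℓ + n)) := fun x y hxy ↦
  Subtype.ext (hinj ℓ n (by rw [← hg, ← hg, hxy]))

/-- The reductions of the sub-tower are surjective when `f (ℓ+n) n (Fil (ℓ+n)) = Fil n` (ONTO).
[cite: Howard2004HeegnerKolyvagin, Def. 3.2.6 and Lemma 3.2.7 (arXiv p. 16)] [folklore] -/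
theorem subFamily_surjective (honto : ∀ ℓ n, ∀ w' ∈ Fil n, ∃ w ∈ Fil (ℓ + n), f (ℓ + n) n w = w') (ℓ n : ℕ) :
    Function.Surjective (g (ℓ + n) n) := fun y ↦ by
  obtain ⟨w, hw, hwy⟩ := honto ℓ n y y.2
  exact ⟨⟨w, hw⟩, Subtype.ext ((hg _ _ _).trans hwy)⟩

/-- **Exactness of the sub-tower** `0 → Fil ℓ → Fil (ℓ+n) → Fil n → 0` from exactness of the tower and the SATURATION
`f ℓ (ℓ+n) ⁻¹ (Fil (ℓ+n)) = Fil ℓ` (SAT). [cite: Howard2004HeegnerKolyvagin, §1.6 and Def. 3.2.6 (arXiv p. 12, p. 16)] [folklore] -/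
theorem subFamily_exact (hex : ∀ ℓ n (y : W (ℓ + n)), f (ℓ + n) n y = 0 ↔ ∃ x, f ℓ (ℓ + n) x = y)
    (hsat : ∀ ℓ n (w : W ℓ), f ℓ (ℓ + n) w ∈ Fil (ℓ + n) → w ∈ Fil ℓ) (ℓ n : ℕ) (y : Fil (ℓ + n)) :
    g (ℓ + n) n y = 0 ↔ ∃ x, g ℓ (ℓ + n) x = y := by
  constructor
  · intro hy
    have hy' : f (ℓ + n) n (y : W (ℓ + n)) = 0 := by
      rw [← hg]; exact congrArg Subtype.val hy
    obtain ⟨x, hx⟩ := (hex ℓ n _).mp hy'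
    exact ⟨⟨x, hsat ℓ n x (hx ▸ y.2)⟩, Subtype.ext ((hg _ _ _).trans hx)⟩
  · rintro ⟨x, rfl⟩
    exact Subtype.ext (by rw [hg, hg, ZeroMemClass.coe_zero]; exact (hex ℓ n _).mpr ⟨x, rfl⟩)

/-- `×π^n` on the sub-tower: `g ℓ (ℓ+n) ∘ g (ℓ+n) ℓ = p^n •`. [cite: Howard2004HeegnerKolyvagin, Def. 1.1.3 (arXiv p. 5)] [folklore] -/
theorem subFamily_pow (p : ℕ) (hpow : ∀ ℓ n (w : W (ℓ + n)), f ℓ (ℓ + n) (f (ℓ + n) ℓ w) = p ^ n • w)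
    (ℓ n : ℕ) (w : Fil (ℓ + n)) : g ℓ (ℓ + n) (g (ℓ + n) ℓ w) = p ^ n • w :=
  Subtype.ext (by rw [hg, hg, hpow]; rfl)

omit [∀ j, TopologicalSpace (W j)] [∀ j, DiscreteTopology (W j)] hg in
/-- The levels of the sub-tower are killed by `p^j`. [cite: Howard2004HeegnerKolyvagin, §1.6 (arXiv p. 12)] [folklore] -/
theorem subFamily_kill (p : ℕ) (hkill : ∀ j (w : W j), p ^ j • w = 0) (j : ℕ) (w : Fil j) : p ^ j • w = 0 := by
  apply Subtype.ext
  push_cast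
  exact hkill j w

end Sub

/-! ## §2 The induced family on the quotient tower `W j ⧸ Fil j` -/

section Quot

/-- **Existence of the induced family**: if every `f a b` maps `Fil a` into `Fil b`, there is a two-index family of
continuous equivariant maps `q a b : W a ⧸ Fil a → W b ⧸ Fil b` of the quotient modules (tree `ContinuousRep.quotient`) with
`q a b (mk x) = mk (f a b x)` (`Submodule.mapQ`). [cite: Howard2004HeegnerKolyvagin, Def. 3.2.5 (arXiv p. 16: gr_v 𝐓 = 𝐓 / Fil_v 𝐓)] [folklore] -/
theorem exists_quotFamily_apply_mk (hmap : ∀ a b, ∀ w ∈ Fil a, f a b w ∈ Fil b) :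
    ∃ q : ∀ a b, ((ρ a).quotient (Fil a) (hΓ a)).toContRepresentation →ⁱL
        ((ρ b).quotient (Fil b) (hΓ b)).toContRepresentation,
      ∀ a b (x : W a), q a b (Submodule.Quotient.mk x) = Submodule.Quotient.mk (f a b x) := by
  have hle : ∀ a b, Fil a ≤ (Fil b).comap (f a b).toContinuousLinearMap.toLinearMap := fun a b w hw ↦ hmap a b w hw
  refine ⟨fun a b ↦
    { toContinuousLinearMap :=
        ⟨(Fil a).mapQ (Fil b) (f a b).toContinuousLinearMap.toLinearMap (hle a b), continuous_of_discreteTopology⟩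
      isIntertwining' := fun σ ↦ by
        refine ContinuousLinearMap.ext fun x ↦ ?_
        induction x using Submodule.Quotient.induction_on with
        | _ w =>
          change (Fil a).mapQ (Fil b) _ (hle a b) (((ρ a).quotient (Fil a) (hΓ a)) σ (Submodule.Quotient.mk w)) =
            ((ρ b).quotient (Fil b) (hΓ b)) σ ((Fil a).mapQ (Fil b) _ (hle a b) (Submodule.Quotient.mk w))
          rw [ContinuousRep.quotient_apply_mk, Submodule.mapQ_apply, Submodule.mapQ_apply,
            ContinuousRep.quotient_apply_mk]
          exact congrArg _ ((f a b).isIntertwining σ w) },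
    fun a b x ↦ rfl⟩

variable {ρ f Fil hΓ}
variable {q : ∀ a b, ((ρ a).quotient (Fil a) (hΓ a)).toContRepresentation →ⁱL
    ((ρ b).quotient (Fil b) (hΓ b)).toContRepresentation}
  (hq : ∀ a b (x : W a), q a b (Submodule.Quotient.mk x) = Submodule.Quotient.mk (f a b x))
include hq

/-- `q a a = id` from `f a a = id`. [cite: Howard2004HeegnerKolyvagin, Def. 1.1.3 (arXiv p. 5)] [folklore] -/
theorem quotFamily_id (hid : ∀ a (w : W a), f a a w = w) (a : ℕ) (x : W a ⧸ Fil a) : q a a x = x := by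
  induction x using Submodule.Quotient.induction_on with
  | _ w => rw [hq, hid]

/-- Reductions compose on the quotient tower. [cite: Howard2004HeegnerKolyvagin, Def. 1.1.3 (arXiv p. 5)] [folklore] -/
theorem quotFamily_comp (hcomp : ∀ a b c, c ≤ b → b ≤ a → ∀ w : W a, f b c (f a b w) = f a c w)
    (a b c : ℕ) (hcb : c ≤ b) (hba : b ≤ a) (x : W a ⧸ Fil a) : q b c (q a b x) = q a c x := by
  induction x using Submodule.Quotient.induction_on with
  | _ w => rw [hq, hq, hq, hcomp a b c hcb hba]

/-- The mixed square on the quotient tower. [cite: Howard2004HeegnerKolyvagin, Def. 1.1.3 (arXiv p. 5)] [folklore] -/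
theorem quotFamily_sq
    (hsq : ∀ a b, a ≤ b → ∀ w : W (a + 1), f a b (f (a + 1) a w) = f (b + 1) b (f (a + 1) (b + 1) w))
    (a b : ℕ) (hab : a ≤ b) (x : W (a + 1) ⧸ Fil (a + 1)) :
    q a b (q (a + 1) a x) = q (b + 1) b (q (a + 1) (b + 1) x) := by
  induction x using Submodule.Quotient.induction_on with
  | _ w => rw [hq, hq, hq, hq, hsq a b hab]

/-- **The up-maps of the quotient tower are injective** from the SATURATION `f ℓ (ℓ+n) ⁻¹ (Fil (ℓ+n)) = Fil ℓ` (SAT).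
[cite: Howard2004HeegnerKolyvagin, §1.6 and Def. 3.2.5 (arXiv p. 12, p. 16)] [folklore] -/
theorem quotFamily_injective (hsat : ∀ ℓ n (w : W ℓ), f ℓ (ℓ + n) w ∈ Fil (ℓ + n) → w ∈ Fil ℓ) (ℓ n : ℕ) :
    Function.Injective (q ℓ (ℓ + n)) := by
  refine (injective_iff_map_eq_zero (q ℓ (ℓ + n))).mpr fun x hx ↦ ?_
  induction x using Submodule.Quotient.induction_on with
  | _ w =>
    rw [hq, Submodule.Quotient.mk_eq_zero] at hx
    exact (Submodule.Quotient.mk_eq_zero _).mpr (hsat ℓ n w hx)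

/-- The reductions of the quotient tower are surjective. [cite: Howard2004HeegnerKolyvagin, §1.6 (arXiv p. 12)] [folklore] -/
theorem quotFamily_surjective (hsurj : ∀ ℓ n, Function.Surjective (f (ℓ + n) n)) (ℓ n : ℕ) :
    Function.Surjective (q (ℓ + n) n) := fun y ↦ by
  induction y using Submodule.Quotient.induction_on with
  | _ w =>
    obtain ⟨x, rfl⟩ := hsurj ℓ n w
    exact ⟨Submodule.Quotient.mk x, hq _ _ x⟩

/-- **Exactness of the quotient tower** `0 → gr ℓ → gr (ℓ+n) → gr n → 0` from exactness of the tower and the levelwise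
surjectivity `f (ℓ+n) n (Fil (ℓ+n)) = Fil n` (ONTO). [cite: Howard2004HeegnerKolyvagin, §1.6 and Def. 3.2.5 (arXiv p. 12, p. 16)] [folklore] -/
theorem quotFamily_exact (hmap : ∀ a b, ∀ w ∈ Fil a, f a b w ∈ Fil b)
    (hex : ∀ ℓ n (y : W (ℓ + n)), f (ℓ + n) n y = 0 ↔ ∃ x, f ℓ (ℓ + n) x = y)
    (honto : ∀ ℓ n, ∀ w' ∈ Fil n, ∃ w ∈ Fil (ℓ + n), f (ℓ + n) n w = w') (ℓ n : ℕ)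
    (y : W (ℓ + n) ⧸ Fil (ℓ + n)) : q (ℓ + n) n y = 0 ↔ ∃ x, q ℓ (ℓ + n) x = y := by
  induction y using Submodule.Quotient.induction_on with
  | _ w =>
    constructor
    · intro hw
      rw [hq, Submodule.Quotient.mk_eq_zero] at hw
      obtain ⟨w', hw', hww'⟩ := honto ℓ n _ hw
      have h0 : f (ℓ + n) n (w - w') = 0 := by rw [map_sub, hww', sub_self]
      obtain ⟨x, hx⟩ := (hex ℓ n _).mp h0
      refine ⟨Submodule.Quotient.mk x, ?_⟩
      rw [hq, hx, Submodule.Quotient.mk_sub, (Submodule.Quotient.mk_eq_zero _).mpr hw', sub_zero]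
    · rintro ⟨x, hx⟩
      induction x using Submodule.Quotient.induction_on with
      | _ u =>
        rw [hq, Submodule.Quotient.eq] at hx
        rw [hq, Submodule.Quotient.mk_eq_zero]
        have h1 : f (ℓ + n) n w = -(f (ℓ + n) n (f ℓ (ℓ + n) u - w)) := by
          rw [map_sub, (hex ℓ n _).mpr ⟨u, rfl⟩, zero_sub, neg_neg]
        rw [h1]
        exact (Fil n).neg_mem (hmap _ _ _ hx)

/-- `×π^n` on the quotient tower: `q ℓ (ℓ+n) ∘ q (ℓ+n) ℓ = p^n •`. [cite: Howard2004HeegnerKolyvagin, Def. 1.1.3 (arXiv p. 5)] [folklore] -/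
theorem quotFamily_pow (p : ℕ) (hpow : ∀ ℓ n (w : W (ℓ + n)), f ℓ (ℓ + n) (f (ℓ + n) ℓ w) = p ^ n • w)
    (ℓ n : ℕ) (w : W (ℓ + n) ⧸ Fil (ℓ + n)) : q ℓ (ℓ + n) (q (ℓ + n) ℓ w) = p ^ n • w := by
  induction w using Submodule.Quotient.induction_on with
  | _ u =>
    rw [hq, hq, hpow]
    exact map_nsmul (Fil (ℓ + n)).mkQ (p ^ n) u

omit [∀ j, TopologicalSpace (W j)] [∀ j, DiscreteTopology (W j)] hq in
/-- The levels of the quotient tower are killed by `p^j`. [cite: Howard2004HeegnerKolyvagin, §1.6 (arXiv p. 12)] [folklore] -/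
theorem quotFamily_kill (p : ℕ) (hkill : ∀ j (w : W j), p ^ j • w = 0) (j : ℕ) (w : W j ⧸ Fil j) :
    p ^ j • w = 0 := by
  induction w using Submodule.Quotient.induction_on with
  | _ u =>
    calc p ^ j • Submodule.Quotient.mk (p := Fil j) u = (Fil j).mkQ (p ^ j • u) :=
        (map_nsmul (Fil j).mkQ (p ^ j) u).symm
      _ = 0 := by rw [hkill, map_zero]

end Quot

/-! ## §3 The sub and quotient presentations as short exact sequences -/

section SES

variable {ρ f Fil hΓ}

/-- **`0 → Fil ℓ → Fil (ℓ+n) → Fil n → 0` is short exact** (tree `IsSES`) for any restricted family, given injectivity and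
exactness of the tower, (ONTO) and (SAT).  (The levelwise sequences `0 → Fil j → W j → W j ⧸ Fil j → 0` are the tree's
`isSES_subtype_mkQ (ρ j) (Fil j) (hΓ j)`; the squares with `g / f / q` hold on elements by `hg`, `hq`.)
[cite: Howard2004HeegnerKolyvagin, §1.6 and Def. 3.2.6 (arXiv p. 12, p. 16)] [cite: SerreGaloisCohomology1997, Ch. I §2.2] -/
theorem isSES_subFamily
    {g : ∀ a b, ((ρ a).subrepresentation (Fil a) (hΓ a)).toContRepresentation →ⁱL
      ((ρ b).subrepresentation (Fil b) (hΓ b)).toContRepresentation}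
    (hg : ∀ a b (x : Fil a), (g a b x : W b) = f a b x)
    (hinj : ∀ ℓ n, Function.Injective (f ℓ (ℓ + n)))
    (hex : ∀ ℓ n (y : W (ℓ + n)), f (ℓ + n) n y = 0 ↔ ∃ x, f ℓ (ℓ + n) x = y)
    (honto : ∀ ℓ n, ∀ w' ∈ Fil n, ∃ w ∈ Fil (ℓ + n), f (ℓ + n) n w = w')
    (hsat : ∀ ℓ n (w : W ℓ), f ℓ (ℓ + n) w ∈ Fil (ℓ + n) → w ∈ Fil ℓ) (ℓ n : ℕ) :
    IsSES (TopRep.ofHom ⟨(g ℓ (ℓ + n)).toContinuousLinearMap, (g ℓ (ℓ + n)).isIntertwining'⟩ :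
        ((ρ ℓ).subrepresentation (Fil ℓ) (hΓ ℓ)).toTopRep ⟶ ((ρ (ℓ + n)).subrepresentation (Fil (ℓ + n)) (hΓ (ℓ + n))).toTopRep)
      (TopRep.ofHom ⟨(g (ℓ + n) n).toContinuousLinearMap, (g (ℓ + n) n).isIntertwining'⟩ :
        ((ρ (ℓ + n)).subrepresentation (Fil (ℓ + n)) (hΓ (ℓ + n))).toTopRep ⟶ ((ρ n).subrepresentation (Fil n) (hΓ n)).toTopRep) :=
  isSES_of_exact _ g (subFamily_injective hg hinj) (subFamily_surjective hg honto) (subFamily_exact hg hex hsat) ℓ n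

/-- **`0 → W ℓ ⧸ Fil ℓ → W (ℓ+n) ⧸ Fil (ℓ+n) → W n ⧸ Fil n → 0` is short exact** for any induced family, given surjectivity and
exactness of the tower, (ONTO) and (SAT). [cite: Howard2004HeegnerKolyvagin, §1.6 and Def. 3.2.5 (arXiv p. 12, p. 16)]
[cite: SerreGaloisCohomology1997, Ch. I §2.2] -/
theorem isSES_quotFamily
    {q : ∀ a b, ((ρ a).quotient (Fil a) (hΓ a)).toContRepresentation →ⁱL
      ((ρ b).quotient (Fil b) (hΓ b)).toContRepresentation}
    (hq : ∀ a b (x : W a), q a b (Submodule.Quotient.mk x) = Submodule.Quotient.mk (f a b x))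
    (hmap : ∀ a b, ∀ w ∈ Fil a, f a b w ∈ Fil b) (hsurj : ∀ ℓ n, Function.Surjective (f (ℓ + n) n))
    (hex : ∀ ℓ n (y : W (ℓ + n)), f (ℓ + n) n y = 0 ↔ ∃ x, f ℓ (ℓ + n) x = y)
    (honto : ∀ ℓ n, ∀ w' ∈ Fil n, ∃ w ∈ Fil (ℓ + n), f (ℓ + n) n w = w')
    (hsat : ∀ ℓ n (w : W ℓ), f ℓ (ℓ + n) w ∈ Fil (ℓ + n) → w ∈ Fil ℓ) (ℓ n : ℕ) :
    IsSES (TopRep.ofHom ⟨(q ℓ (ℓ + n)).toContinuousLinearMap, (q ℓ (ℓ + n)).isIntertwining'⟩ :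
        ((ρ ℓ).quotient (Fil ℓ) (hΓ ℓ)).toTopRep ⟶ ((ρ (ℓ + n)).quotient (Fil (ℓ + n)) (hΓ (ℓ + n))).toTopRep)
      (TopRep.ofHom ⟨(q (ℓ + n) n).toContinuousLinearMap, (q (ℓ + n) n).isIntertwining'⟩ :
        ((ρ (ℓ + n)).quotient (Fil (ℓ + n)) (hΓ (ℓ + n))).toTopRep ⟶ ((ρ n).quotient (Fil n) (hΓ n)).toTopRep) :=
  isSES_of_exact _ q (quotFamily_injective hq hsat) (quotFamily_surjective hq hsurj) (quotFamily_exact hq hmap hex honto) ℓ n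

end SES

/-! ## §4 Transport of (map) / (ONTO) / (SAT) along levelwise automorphisms commuting with the family

For the TWISTED side of Howard's H.4 at `v` (the tower `Tw(W_j)` at `v`, whose plus part is the translate `δ_v · Fil_{σv} W_j` of
the plus part at the conjugate place, `ConjugationDatum.map_delta_le_comap_twist`) the three filtration hypotheses are inherited
from those of `Fil_{σv}` along the levelwise additive bijections `θ_j = ρ_j(δ_v)`, which commute with the `Γ_K`-equivariant
family `f a b`.  Pure module bookkeeping: `θ j : W j →+ W j`, `f a b (θ a w) = θ b (f a b w)`. -/

section Transport

variable {ρ Fil}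
variable (θ : ∀ j, W j →+ W j) (hθf : ∀ a b (w : W a), f a b (θ a w) = θ b (f a b w))
include hθf

/-- (map) transports: if every `f a b` maps `Fil a` into `Fil b`, it maps `θ_a(Fil a)` into `θ_b(Fil b)`.
[cite: Howard2004HeegnerKolyvagin, §1.3 H.4 (arXiv p. 7 L44–48: Tw(T), the transport by δ_v) and Def. 3.2.5] [folklore] -/
theorem map_mem_map_of_comm (hmap : ∀ a b, ∀ w ∈ Fil a, f a b w ∈ Fil b) (a b : ℕ) (w : W a)
    (hw : w ∈ (Fil a).map (θ a).toIntLinearMap) : f a b w ∈ (Fil b).map (θ b).toIntLinearMap := by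
  obtain ⟨u, hu, rfl⟩ := Submodule.mem_map.mp hw
  exact Submodule.mem_map.mpr ⟨f a b u, hmap a b u hu, (hθf a b u).symm⟩

/-- (ONTO) transports: if the reductions map `Fil (ℓ+n)` onto `Fil n`, they map `θ(Fil (ℓ+n))` onto `θ(Fil n)`.
[cite: Howard2004HeegnerKolyvagin, §1.3 H.4 (arXiv p. 7 L44–48) and Def. 3.2.6] [folklore] -/
theorem onto_map_of_comm (honto : ∀ ℓ n, ∀ w' ∈ Fil n, ∃ w ∈ Fil (ℓ + n), f (ℓ + n) n w = w') (ℓ n : ℕ) (w' : W n)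
    (hw' : w' ∈ (Fil n).map (θ n).toIntLinearMap) :
    ∃ w ∈ (Fil (ℓ + n)).map (θ (ℓ + n)).toIntLinearMap, f (ℓ + n) n w = w' := by
  obtain ⟨u', hu', rfl⟩ := Submodule.mem_map.mp hw'
  obtain ⟨u, hu, rfl⟩ := honto ℓ n u' hu'
  exact ⟨θ (ℓ + n) u, Submodule.mem_map.mpr ⟨u, hu, rfl⟩, hθf _ _ u⟩

/-- (SAT) transports along BIJECTIVE `θ`: if `f ℓ (ℓ+n) ⁻¹ (Fil (ℓ+n)) = Fil ℓ` then `f ℓ (ℓ+n) ⁻¹ (θ(Fil (ℓ+n))) = θ(Fil ℓ)`.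
[cite: Howard2004HeegnerKolyvagin, §1.3 H.4 (arXiv p. 7 L44–48) and §1.6 (arXiv p. 12)] [folklore] -/
theorem sat_map_of_comm (hθ : ∀ j, Function.Bijective (θ j))
    (hsat : ∀ ℓ n (w : W ℓ), f ℓ (ℓ + n) w ∈ Fil (ℓ + n) → w ∈ Fil ℓ) (ℓ n : ℕ) (w : W ℓ)
    (hw : f ℓ (ℓ + n) w ∈ (Fil (ℓ + n)).map (θ (ℓ + n)).toIntLinearMap) :
    w ∈ (Fil ℓ).map (θ ℓ).toIntLinearMap := by
  obtain ⟨u, rfl⟩ := (hθ ℓ).2 w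
  obtain ⟨u', hu', hu'eq⟩ := Submodule.mem_map.mp hw
  have hfu : f ℓ (ℓ + n) u = u' := (hθ (ℓ + n)).1 (by rw [← hθf]; exact hu'eq.symm)
  exact Submodule.mem_map.mpr ⟨u, hsat ℓ n u (hfu ▸ hu'), rfl⟩

end Transport

end Tower

end Literature.NumberTheory.EllipticCurves

end
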